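import Mathlib

/-!
# Far-field VELOCITY tail from length regularity (tools stub `stub_velocityTailTools`, line `zero-accretion-selection`)

Companion of the landed `stub_tameVerticalToolsC` (p166186, the `r⁻³` strain-kernel tail) for the VELOCITY
kernel: the regularised Biot–Savart integrand of a filament has norm
`≤ ‖r‖((‖r‖²+1)^(3/2))⁻¹ ≤ (‖r‖²+1)⁻¹`, `r = x₁ − X σ`, and if the curve is LENGTH-REGULAR around `x₁`
at scales `≥ D₀` (`D₀ ≥ 1`: measure of parameters in the `D`-ball `≤ C₀ D`) then for `A ≥ D₀`
`∫_{A ≤ ‖X σ − x₁‖} (‖x₁ − X σ‖² + 1)⁻¹ dσ ≤ 4 C₀ / A` (dyadic shells: measure `≤ C₀2ⁿ⁺¹A`, integrand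
`≤ (2ⁿA)⁻²`). This is the mutual-induction bound used by the XL core's shadowing step (memo §4(b): other
filaments are `ρ√Γ`-separated, so their whole induced velocity at a waist is `≤ Σ_k (Γ|γ_k|/4π)·4C₀/(ρ√Γ)`,
i.e. `O(√Γ)` in filament units = `O(1)` in waist units) and by the waist-localisation estimates.
Shell bookkeeping adapted from p166186 / p165350.
-/

noncomputable section

open MeasureTheory

namespace Summit.NavierStokesRegularity.NavierStokesRegularity.Theorems.SkeletonEquilibrium.ZeroAccretionSelection
set_option linter.dupNamespace false

/-- `(‖z‖² + 1)⁻¹ ≤ 1`. [folklore] -/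
private theorem vtt_kernel_le_one (z : EuclideanSpace ℝ (Fin 3)) : (‖z‖ ^ 2 + 1)⁻¹ ≤ 1 :=
  inv_le_one_of_one_le₀ (le_add_of_nonneg_left (sq_nonneg _))

/-- `(‖z‖² + 1)⁻¹ ≤ B⁻²` whenever `0 < B ≤ ‖z‖`. [folklore] -/
private theorem vtt_kernel_le_of_le {z : EuclideanSpace ℝ (Fin 3)} {B : ℝ} (hB : 0 < B)
    (hz : B ≤ ‖z‖) : (‖z‖ ^ 2 + 1)⁻¹ ≤ (B ^ 2)⁻¹ := by
  refine inv_anti₀ (pow_pos hB 2) ?_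
  calc B ^ 2 ≤ ‖z‖ ^ 2 := pow_le_pow_left₀ hB.le hz 2
    _ ≤ ‖z‖ ^ 2 + 1 := le_add_of_nonneg_right zero_le_one

/-- Continuity in `σ` of `σ ↦ (‖z − X σ‖² + 1)⁻¹`. [folklore] -/
private theorem vtt_continuous_kernel {X : ℝ → EuclideanSpace ℝ (Fin 3)} (hXc : Continuous X)
    (z : EuclideanSpace ℝ (Fin 3)) :
    Continuous (fun σ : ℝ => (‖z - X σ‖ ^ 2 + 1)⁻¹) := by
  have hpos : ∀ σ, (0 : ℝ) < ‖z - X σ‖ ^ 2 + 1 := fun σ => by positivity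
  exact (((continuous_const.sub hXc).norm.pow 2).add continuous_const).inv₀ fun σ => (hpos σ).ne'

/-- **Far-field velocity tail (Lebesgue-integral form).** Under length regularity at scales `≥ D₀ ≥ 1`
around `x₁`, for `A ≥ D₀`: `∫⁻_{A ≤ ‖X σ − x₁‖} (‖x₁ − X σ‖² + 1)⁻¹ ≤ 4 C₀ / A`. [folklore] -/
private theorem vtt_tail_lintegral {X : ℝ → EuclideanSpace ℝ (Fin 3)}
    {x₁ : EuclideanSpace ℝ (Fin 3)} {C₀ D₀ A : ℝ} (hC₀ : 0 ≤ C₀) (hD₀ : 1 ≤ D₀) (hA : D₀ ≤ A)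
    (hlen : ∀ D : ℝ, D₀ ≤ D → volume {σ : ℝ | ‖X σ - x₁‖ ≤ D} ≤ ENNReal.ofReal (C₀ * D)) :
    ∫⁻ σ in {σ : ℝ | A ≤ ‖X σ - x₁‖}, ENNReal.ofReal ((‖x₁ - X σ‖ ^ 2 + 1)⁻¹) ≤
      ENNReal.ofReal (4 * C₀ / A) := by
  have hApos : 0 < A := one_pos.trans_le (hD₀.trans hA)
  have hA0 : A ≠ 0 := hApos.ne'
  set S : ℕ → Set ℝ := fun n => {σ | 2 ^ n * A ≤ ‖X σ - x₁‖ ∧ ‖X σ - x₁‖ < 2 ^ (n + 1) * A}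
    with hS
  have hcover : {σ : ℝ | A ≤ ‖X σ - x₁‖} ⊆ ⋃ n, S n := by
    intro σ hσ
    obtain ⟨n, hn1, hn2⟩ := exists_nat_pow_near ((one_le_div hApos).mpr hσ) one_lt_two
    exact Set.mem_iUnion.mpr ⟨n, (le_div_iff₀ hApos).mp hn1, (div_lt_iff₀ hApos).mp hn2⟩
  have hS_int : ∀ n : ℕ,
      ∫⁻ σ in S n, ENNReal.ofReal ((‖x₁ - X σ‖ ^ 2 + 1)⁻¹) ≤
        ENNReal.ofReal (2 * C₀ / A * ((1 : ℝ) / 2) ^ n) := by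
    intro n
    have h2n : (0 : ℝ) < 2 ^ n := by positivity
    have hBpos : 0 < 2 ^ n * A := mul_pos h2n hApos
    have hle : D₀ ≤ 2 ^ (n + 1) * A :=
      hA.trans (le_mul_of_one_le_left hApos.le (one_le_pow₀ (by norm_num)))
    calc ∫⁻ σ in S n, ENNReal.ofReal ((‖x₁ - X σ‖ ^ 2 + 1)⁻¹)
        ≤ ∫⁻ _ in S n, ENNReal.ofReal (((2 ^ n * A) ^ 2)⁻¹) := by
          refine setLIntegral_mono measurable_const fun σ hσ => ENNReal.ofReal_le_ofReal ?_
          have h1 : 2 ^ n * A ≤ ‖x₁ - X σ‖ := by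
            rw [norm_sub_rev]
            exact hσ.1
          exact vtt_kernel_le_of_le hBpos h1
      _ = ENNReal.ofReal (((2 ^ n * A) ^ 2)⁻¹) * volume (S n) := setLIntegral_const _ _
      _ ≤ ENNReal.ofReal (((2 ^ n * A) ^ 2)⁻¹) * ENNReal.ofReal (C₀ * (2 ^ (n + 1) * A)) := by
          gcongr
          exact (measure_mono fun σ hσ => hσ.2.le).trans (hlen _ hle)
      _ = ENNReal.ofReal (((2 ^ n * A) ^ 2)⁻¹ * (C₀ * (2 ^ (n + 1) * A))) :=
          (ENNReal.ofReal_mul (by positivity)).symm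
      _ = ENNReal.ofReal (2 * C₀ / A * ((1 : ℝ) / 2) ^ n) := by
          congr 1
          rw [one_div, inv_pow]
          field_simp
          ring
  have hsum : Summable fun n : ℕ => 2 * C₀ / A * ((1 : ℝ) / 2) ^ n :=
    summable_geometric_two.mul_left _
  calc ∫⁻ σ in {σ : ℝ | A ≤ ‖X σ - x₁‖}, ENNReal.ofReal ((‖x₁ - X σ‖ ^ 2 + 1)⁻¹)
      ≤ ∫⁻ σ in ⋃ n, S n, ENNReal.ofReal ((‖x₁ - X σ‖ ^ 2 + 1)⁻¹) := lintegral_mono_set hcover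
    _ ≤ ∑' n, ∫⁻ σ in S n, ENNReal.ofReal ((‖x₁ - X σ‖ ^ 2 + 1)⁻¹) := lintegral_iUnion_le _ _
    _ ≤ ∑' n : ℕ, ENNReal.ofReal (2 * C₀ / A * ((1 : ℝ) / 2) ^ n) := ENNReal.tsum_le_tsum hS_int
    _ = ENNReal.ofReal (∑' n : ℕ, 2 * C₀ / A * ((1 : ℝ) / 2) ^ n) :=
        (ENNReal.ofReal_tsum_of_nonneg (fun n => by positivity) hsum).symm
    _ = ENNReal.ofReal (4 * C₀ / A) := by
        congr 1
        rw [tsum_mul_left, tsum_geometric_two]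
        ring

/-- **Integrability from length regularity (velocity kernel).** [folklore] -/
private theorem vtt_integrable {X : ℝ → EuclideanSpace ℝ (Fin 3)} (hXc : Continuous X)
    (x₁ : EuclideanSpace ℝ (Fin 3)) {C₀ D₀ : ℝ} (hC₀ : 0 ≤ C₀) (hD₀ : 1 ≤ D₀)
    (hlen : ∀ D : ℝ, D₀ ≤ D → volume {σ : ℝ | ‖X σ - x₁‖ ≤ D} ≤ ENNReal.ofReal (C₀ * D)) :
    Integrable (fun σ : ℝ => (‖x₁ - X σ‖ ^ 2 + 1)⁻¹) := by
  have hnn : ∀ σ, 0 ≤ (‖x₁ - X σ‖ ^ 2 + 1)⁻¹ := fun σ => by positivity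
  refine ⟨(vtt_continuous_kernel hXc x₁).aestronglyMeasurable,
    (hasFiniteIntegral_iff_ofReal (Filter.Eventually.of_forall hnn)).2 ?_⟩
  set S₀ : Set ℝ := {σ | ‖X σ - x₁‖ < D₀} with hS₀
  set T : Set ℝ := {σ | D₀ ≤ ‖X σ - x₁‖} with hT
  have hcover : S₀ ∪ T = Set.univ := by
    refine Set.eq_univ_of_forall fun σ => ?_
    rcases lt_or_ge ‖X σ - x₁‖ D₀ with h | h
    · exact Or.inl h
    · exact Or.inr h
  have h0 : ∫⁻ σ in S₀, ENNReal.ofReal ((‖x₁ - X σ‖ ^ 2 + 1)⁻¹) ≤ ENNReal.ofReal (C₀ * D₀) := by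
    calc ∫⁻ σ in S₀, ENNReal.ofReal ((‖x₁ - X σ‖ ^ 2 + 1)⁻¹)
        ≤ ∫⁻ _ in S₀, 1 := lintegral_mono fun σ => ENNReal.ofReal_le_one.2 (vtt_kernel_le_one _)
      _ = volume S₀ := setLIntegral_one _
      _ ≤ volume {σ : ℝ | ‖X σ - x₁‖ ≤ D₀} :=
          measure_mono fun σ hσ => show ‖X σ - x₁‖ ≤ D₀ from le_of_lt (show ‖X σ - x₁‖ < D₀ from hσ)
      _ ≤ ENNReal.ofReal (C₀ * D₀) := hlen D₀ le_rfl
  have h1 : ∫⁻ σ in T, ENNReal.ofReal ((‖x₁ - X σ‖ ^ 2 + 1)⁻¹) ≤ ENNReal.ofReal (4 * C₀ / D₀) :=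
    vtt_tail_lintegral hC₀ hD₀ le_rfl hlen
  calc ∫⁻ σ, ENNReal.ofReal ((‖x₁ - X σ‖ ^ 2 + 1)⁻¹)
      = ∫⁻ σ in S₀ ∪ T, ENNReal.ofReal ((‖x₁ - X σ‖ ^ 2 + 1)⁻¹) := by rw [hcover, Measure.restrict_univ]
    _ ≤ (∫⁻ σ in S₀, ENNReal.ofReal ((‖x₁ - X σ‖ ^ 2 + 1)⁻¹)) +
          ∫⁻ σ in T, ENNReal.ofReal ((‖x₁ - X σ‖ ^ 2 + 1)⁻¹) := lintegral_union_le _ _ _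
    _ < ⊤ := ENNReal.add_lt_top.2 ⟨h0.trans_lt ENNReal.ofReal_lt_top, h1.trans_lt ENNReal.ofReal_lt_top⟩

/-- Conjunct 2: the far-field tail integral (Bochner) is `≤ 4 C₀ / A`. [folklore] -/
private theorem vtt_conj2 :
    ∀ (X : ℝ → EuclideanSpace ℝ (Fin 3)) (x₁ : EuclideanSpace ℝ (Fin 3)) (C₀ D₀ A : ℝ),
      Continuous X → 0 ≤ C₀ → 1 ≤ D₀ → D₀ ≤ A →
      (∀ D : ℝ, D₀ ≤ D → volume {σ : ℝ | ‖X σ - x₁‖ ≤ D} ≤ ENNReal.ofReal (C₀ * D)) →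
      IntegrableOn (fun σ : ℝ => (‖x₁ - X σ‖ ^ 2 + 1)⁻¹) {σ : ℝ | A ≤ ‖X σ - x₁‖} ∧
        ∫ σ in {σ : ℝ | A ≤ ‖X σ - x₁‖}, (‖x₁ - X σ‖ ^ 2 + 1)⁻¹ ≤ 4 * C₀ / A := by
  intro X x₁ C₀ D₀ A hXc hC₀ hD₀ hA hlen
  refine ⟨(vtt_integrable hXc x₁ hC₀ hD₀ hlen).integrableOn, ?_⟩
  have hApos : 0 < A := one_pos.trans_le (hD₀.trans hA)
  rw [integral_eq_lintegral_of_nonneg_ae (Filter.Eventually.of_forall fun σ => by positivity)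
    (vtt_continuous_kernel hXc x₁).aestronglyMeasurable]
  exact ENNReal.toReal_le_of_le_ofReal (by positivity) (vtt_tail_lintegral hC₀ hD₀ hA hlen)

/-- The velocity kernel is dominated by `(‖r‖² + 1)⁻¹`: `‖r‖((‖r‖²+1)^(3/2))⁻¹ ≤ (‖r‖²+1)⁻¹`. [folklore] -/
theorem norm_mul_kernel_le (r : EuclideanSpace ℝ (Fin 3)) :
    ‖r‖ * ((‖r‖ ^ 2 + 1) ^ (3 / 2 : ℝ))⁻¹ ≤ (‖r‖ ^ 2 + 1)⁻¹ := by
  have hq : 0 < ‖r‖ ^ 2 + 1 := by positivity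
  have h32 : (‖r‖ ^ 2 + 1) ^ (3 / 2 : ℝ) = (‖r‖ ^ 2 + 1) * Real.sqrt (‖r‖ ^ 2 + 1) := by
    rw [show (3 / 2 : ℝ) = 1 + 1 / 2 by norm_num, Real.rpow_add hq, Real.rpow_one, Real.sqrt_eq_rpow]
  have hsq : ‖r‖ ≤ Real.sqrt (‖r‖ ^ 2 + 1) := by
    rw [Real.le_sqrt (norm_nonneg _) hq.le]; linarith
  have hs0 : 0 < Real.sqrt (‖r‖ ^ 2 + 1) := Real.sqrt_pos.2 hq
  rw [h32]
  rw [show ‖r‖ * ((‖r‖ ^ 2 + 1) * Real.sqrt (‖r‖ ^ 2 + 1))⁻¹ =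
      (‖r‖ / Real.sqrt (‖r‖ ^ 2 + 1)) * (‖r‖ ^ 2 + 1)⁻¹ by field_simp]
  calc ‖r‖ / Real.sqrt (‖r‖ ^ 2 + 1) * (‖r‖ ^ 2 + 1)⁻¹ ≤ 1 * (‖r‖ ^ 2 + 1)⁻¹ := by
        gcongr
        rw [div_le_one hs0]; exact hsq
    _ = (‖r‖ ^ 2 + 1)⁻¹ := one_mul _

/-- **Registered tools stub `stub_velocityTailTools`** (line `zero-accretion-selection`): whole-line integrability of the
velocity majorant `(‖x₁ − Xσ‖²+1)⁻¹` from length regularity, its far-field tail `≤ 4C₀/A`, and the domination of the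
regularised Biot–Savart velocity kernel by it. [folklore] -/
theorem stub_velocityTailTools :
    (∀ (X : ℝ → EuclideanSpace ℝ (Fin 3)) (x₁ : EuclideanSpace ℝ (Fin 3)) (C₀ D₀ : ℝ), Continuous X → 0 ≤ C₀ → 1 ≤ D₀ →
      (∀ D : ℝ, D₀ ≤ D → volume {σ : ℝ | ‖X σ - x₁‖ ≤ D} ≤ ENNReal.ofReal (C₀ * D)) →
      Integrable (fun σ : ℝ => (‖x₁ - X σ‖ ^ 2 + 1)⁻¹)) ∧
    (∀ (X : ℝ → EuclideanSpace ℝ (Fin 3)) (x₁ : EuclideanSpace ℝ (Fin 3)) (C₀ D₀ A : ℝ), Continuous X → 0 ≤ C₀ → 1 ≤ D₀ → D₀ ≤ A →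
      (∀ D : ℝ, D₀ ≤ D → volume {σ : ℝ | ‖X σ - x₁‖ ≤ D} ≤ ENNReal.ofReal (C₀ * D)) →
      IntegrableOn (fun σ : ℝ => (‖x₁ - X σ‖ ^ 2 + 1)⁻¹) {σ : ℝ | A ≤ ‖X σ - x₁‖} ∧
        ∫ σ in {σ : ℝ | A ≤ ‖X σ - x₁‖}, (‖x₁ - X σ‖ ^ 2 + 1)⁻¹ ≤ 4 * C₀ / A) ∧
    (∀ (r : EuclideanSpace ℝ (Fin 3)), ‖r‖ * ((‖r‖ ^ 2 + 1) ^ (3 / 2 : ℝ))⁻¹ ≤ (‖r‖ ^ 2 + 1)⁻¹) :=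
  ⟨fun _ x₁ _ _ hXc hC₀ hD₀ hlen => vtt_integrable hXc x₁ hC₀ hD₀ hlen, vtt_conj2, norm_mul_kernel_le⟩

end Summit.NavierStokesRegularity.NavierStokesRegularity.Theorems.SkeletonEquilibrium.ZeroAccretionSelection
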